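import Summits.QuantumAdvantage.AdviceFreeQNC0.NPGamma37
import HarnessLib

/-!
# Cell qa-qnc0 — `RingHardFewCouplings3` from (NP-Γ): ZONE-GREEDY window selection (planner qa-qnc0-p2 g34, P2-34d)

`insulated_of_light`/`insulated_of_few`: if `(2F+1)·z + 6 ≤ n` and `4m + (D+1)(4(2F+1)D+2) ≤ (D+1)z` (`m` = number of
coupled pairs), then `NPGamma37.InsulatedWindows 𝓢 F`.  Proof: cut `[2, n−4)` into `2F+1` zones of length `z`; in zone
`k` choose a domino `{t_k, t_k+1}` of LIGHT positions (coupling degree `≤ D`) not coupled to the dominoes already chosen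
(`good_succ`: forbidden starts `≤ 2(#heavy + 2kD) < z − 1`, `#heavy·(D+1) ≤ 2m` by `heavy_markov`); even dominoes are
the insulators, odd ones the free pairs.  `ringHardFewCouplings3_of_sparse`: **`RingHardFewCouplings3`** (e = 6,
C = 2^21, n₀ = 4096) from the explicit (NP-Γ) `SparseExplicit` (proved in `NPGamma37Sparse`).
-/

noncomputable section

namespace Summit.QuantumAdvantage.AdviceFreeQNC0.NPGamma37Few

open Finset Classical
open Literature.Computability.QuantumComplexity Literature.Computability.MetaComplexity
open Summit.QuantumAdvantage.AdviceFreeQNC0.NPGamma37 (NCoupled InsulatedWindows RingHardSparse3 RingHardFewCouplings3)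

variable {n : ℕ}

/-- Coupling is symmetric. -/
theorem ncoupled_symm {𝓢 : Set (Finset (Fin n))} {i i' : ℕ} (h : NCoupled 𝓢 i i') : NCoupled 𝓢 i' i := by
  obtain ⟨S, hS, a, ha, b, hb, hai, hbi⟩ := h
  exact ⟨S, hS, b, hb, a, ha, hbi, hai⟩

/-- the positions (as naturals) other than `c` coupled to `c`. -/
def nbrN (𝓢 : Set (Finset (Fin n))) (c : ℕ) : Finset ℕ :=
  ((univ : Finset (Fin n)).filter fun i : Fin n => (i : ℕ) ≠ c ∧ NCoupled 𝓢 c (i : ℕ)).map Fin.valEmbedding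
/-- Membership in the coupling neighbourhood `nbrN 𝓢 c`. -/
theorem mem_nbrN {𝓢 : Set (Finset (Fin n))} {c i : ℕ} :
    i ∈ nbrN 𝓢 c ↔ i < n ∧ i ≠ c ∧ NCoupled 𝓢 c i := by
  unfold nbrN
  constructor
  · intro h
    rw [Finset.mem_map] at h
    obtain ⟨a, ha, rfl⟩ := h
    rw [Finset.mem_filter] at ha
    exact ⟨a.isLt, ha.2.1, ha.2.2⟩
  · rintro ⟨hi, hic, hc⟩
    rw [Finset.mem_map]
    exact ⟨⟨i, hi⟩, by rw [Finset.mem_filter]; exact ⟨mem_univ _, hic, hc⟩, rfl⟩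
/-- A position outside the coupling neighbourhood of `c` is not coupled to `c`. -/
theorem not_coupled_of_not_mem {𝓢 : Set (Finset (Fin n))} {c i : ℕ} (hi : i < n) (hic : i ≠ c)
    (h : i ∉ nbrN 𝓢 c) : ¬ NCoupled 𝓢 c i := fun hc => h (mem_nbrN.mpr ⟨hi, hic, hc⟩)
/-- the HEAVY positions: coupling degree `> D`. -/
def heavy (𝓢 : Set (Finset (Fin n))) (D : ℕ) : Finset (Fin n) :=
  univ.filter fun a : Fin n => D < (nbrN 𝓢 a).card
/-- the coupled (unordered, `a < b`) pairs. -/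
def cpairs (𝓢 : Set (Finset (Fin n))) : Finset (Fin n × Fin n) :=
  univ.filter fun ab : Fin n × Fin n => ab.1 < ab.2 ∧ NCoupled 𝓢 ab.1 ab.2
/-- the coupled ordered pairs. -/
def opairs (𝓢 : Set (Finset (Fin n))) : Finset (Fin n × Fin n) :=
  univ.filter fun ab : Fin n × Fin n => ab.1 ≠ ab.2 ∧ NCoupled 𝓢 ab.1 ab.2
/-- Ordered coupled pairs are twice the unordered ones. -/
theorem card_opairs (𝓢 : Set (Finset (Fin n))) : (opairs 𝓢).card = 2 * (cpairs 𝓢).card := by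
  have hsplit : opairs 𝓢 = cpairs 𝓢 ∪ (cpairs 𝓢).image Prod.swap := by
    ext ⟨a, b⟩
    simp only [opairs, cpairs, Finset.mem_union, Finset.mem_filter, Finset.mem_univ, true_and,
      Finset.mem_image, Prod.exists, Prod.swap_prod_mk, Prod.mk.injEq]
    constructor
    · rintro ⟨hne, hc⟩
      rcases lt_or_gt_of_ne hne with h | h
      · exact Or.inl ⟨h, hc⟩
      · exact Or.inr ⟨b, a, ⟨h, ncoupled_symm hc⟩, rfl, rfl⟩
    · rintro (⟨h, hc⟩ | ⟨c, d, ⟨h, hc⟩, rfl, rfl⟩)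
      · exact ⟨ne_of_lt h, hc⟩
      · exact ⟨(ne_of_lt h).symm, ncoupled_symm hc⟩
  have hdisj : Disjoint (cpairs 𝓢) ((cpairs 𝓢).image Prod.swap) := by
    rw [Finset.disjoint_left]
    rintro ⟨a, b⟩ h1 h2
    simp only [cpairs, Finset.mem_filter, Finset.mem_univ, true_and, Finset.mem_image, Prod.exists,
      Prod.swap_prod_mk, Prod.mk.injEq] at h1 h2
    obtain ⟨c, d, ⟨h, _⟩, rfl, rfl⟩ := h2
    exact lt_asymm h h1.1
  rw [hsplit, Finset.card_union_of_disjoint hdisj,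
    Finset.card_image_of_injective _ Prod.swap_injective]
  ring
/-- Double counting: `Σ_a #nbrN(a) = 2·#cpairs`. -/
theorem sum_card_nbr (𝓢 : Set (Finset (Fin n))) :
    ∑ a : Fin n, (nbrN 𝓢 a).card = 2 * (cpairs 𝓢).card := by
  rw [← card_opairs]
  unfold opairs
  rw [Finset.card_eq_sum_card_fiberwise (f := Prod.fst) (t := (univ : Finset (Fin n)))
    (fun _ _ => mem_univ _)]
  refine Finset.sum_congr rfl fun a _ => ?_
  unfold nbrN
  rw [Finset.card_map]
  refine Finset.card_bij (fun i _ => (a, i)) ?_ ?_ ?_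
  · intro i hi
    simp only [Finset.mem_filter, Finset.mem_univ, true_and] at hi ⊢
    exact ⟨⟨fun h => hi.1 (congrArg Fin.val h).symm, hi.2⟩, trivial⟩
  · intro i _ i' _ h
    exact (Prod.mk.injEq _ _ _ _).mp h |>.2
  · rintro ⟨b, c⟩ h
    simp only [Finset.mem_filter, Finset.mem_univ, true_and] at h
    obtain ⟨⟨hne, hc⟩, rfl⟩ := h
    exact ⟨c, by simp only [Finset.mem_filter, Finset.mem_univ, true_and]; exact ⟨fun h => hne (Fin.ext h.symm), hc⟩, rfl⟩
/-- Markov: `#heavy · (D+1) ≤ 2m`. -/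
theorem heavy_markov (𝓢 : Set (Finset (Fin n))) (D : ℕ) :
    (heavy 𝓢 D).card * (D + 1) ≤ 2 * (cpairs 𝓢).card := by
  rw [← sum_card_nbr]
  calc (heavy 𝓢 D).card * (D + 1) = ∑ _a ∈ heavy 𝓢 D, (D + 1) := by rw [Finset.sum_const, smul_eq_mul]
    _ ≤ ∑ a ∈ heavy 𝓢 D, (nbrN 𝓢 a).card := Finset.sum_le_sum fun a ha => by
        simp only [heavy, Finset.mem_filter] at ha; exact ha.2
    _ ≤ ∑ a : Fin n, (nbrN 𝓢 a).card :=
        Finset.sum_le_sum_of_subset_of_nonneg (Finset.filter_subset _ _) fun _ _ _ => Nat.zero_le _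
/-- `k` good dominoes: domino `j` = `{t j, t j + 1}` lies in zone `j` = `[2 + j z, 2 + (j+1) z)`, both positions are
light, and no position of a domino is coupled to a position of another domino. -/
def Good (𝓢 : Set (Finset (Fin n))) (D z k : ℕ) (t : ℕ → ℕ) : Prop :=
  (∀ j < k, 2 + j * z ≤ t j ∧ t j + 1 < 2 + (j + 1) * z) ∧
  (∀ j < k, (nbrN 𝓢 (t j)).card ≤ D ∧ (nbrN 𝓢 (t j + 1)).card ≤ D) ∧
  (∀ j < k, ∀ j' < k, j ≠ j' → ∀ a ∈ ({t j, t j + 1} : Finset ℕ), ∀ b ∈ ({t j', t j' + 1} : Finset ℕ),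
      ¬ NCoupled 𝓢 a b)
/-- The empty selection is good. -/
theorem good_zero (𝓢 : Set (Finset (Fin n))) (D z : ℕ) : Good 𝓢 D z 0 (fun _ => 0) :=
  ⟨fun _ hj => absurd hj (Nat.not_lt_zero _), fun _ hj => absurd hj (Nat.not_lt_zero _),
    fun _ hj => absurd hj (Nat.not_lt_zero _)⟩
/-- a free start in a zone: if `2·#B + 2 ≤ z` then some `s` with `L ≤ s`, `s + 1 < L + z` has `s, s+1 ∉ B`. -/
theorem exists_free_start (B : Finset ℕ) (L z : ℕ) (hz : 2 * B.card + 2 ≤ z) :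
    ∃ s, L ≤ s ∧ s + 1 < L + z ∧ s ∉ B ∧ s + 1 ∉ B := by
  by_contra h
  push Not at h
  have hsub : Finset.Ico L (L + (z - 1)) ⊆ B ∪ B.image (fun x => x - 1) := by
    intro s hs
    rw [Finset.mem_Ico] at hs
    rw [Finset.mem_union, Finset.mem_image]
    by_cases hsB : s ∈ B
    · exact Or.inl hsB
    · exact Or.inr ⟨s + 1, h s hs.1 (by omega) hsB, by omega⟩
  have hcard := Finset.card_le_card hsub
  rw [Nat.card_Ico] at hcard
  have h2 := (Finset.card_union_le B (B.image (fun x => x - 1))).trans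
    (Nat.add_le_add_left (Finset.card_image_le) _)
  omega
/-- Greedy step: in zone `k` a light, unblocked domino extends a good selection. -/
theorem good_succ {𝓢 : Set (Finset (Fin n))} {D z k K : ℕ} {t : ℕ → ℕ} (hg : Good 𝓢 D z k t) (hk : k < K)
    (hKz : K * z + 6 ≤ n) (hz : 2 * (heavy 𝓢 D).card + 4 * K * D + 2 ≤ z) :
    ∃ s, Good 𝓢 D z (k + 1) (fun j => if j = k then s else t j) := by
  obtain ⟨hzone, hlight, hnc⟩ := hg
  -- the forbidden positions: heavy ones and those coupled to the dominoes already chosen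
  set P : Finset ℕ := (Finset.range k).biUnion fun j => nbrN 𝓢 (t j) ∪ nbrN 𝓢 (t j + 1) with hP
  set H : Finset ℕ := (heavy 𝓢 D).map Fin.valEmbedding with hH
  have hPcard : P.card ≤ k * (2 * D) := by
    calc P.card ≤ ∑ j ∈ Finset.range k, (nbrN 𝓢 (t j) ∪ nbrN 𝓢 (t j + 1)).card := Finset.card_biUnion_le
      _ ≤ ∑ _j ∈ Finset.range k, 2 * D := Finset.sum_le_sum fun j hj => by
          rw [Finset.mem_range] at hj
          have := hlight j hj
          exact (Finset.card_union_le _ _).trans (by omega)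
      _ = k * (2 * D) := by rw [Finset.sum_const, Finset.card_range, smul_eq_mul]
  have hHcard : H.card = (heavy 𝓢 D).card := Finset.card_map _
  have hBcard : 2 * (H ∪ P).card + 2 ≤ z := by
    have h1 := Finset.card_union_le H P
    have hkK : k * (2 * D) ≤ K * (2 * D) := Nat.mul_le_mul_right _ hk.le
    have : 4 * K * D = 2 * (K * (2 * D)) := by ring
    omega
  obtain ⟨s, hLs, hsz, hsB, hs1B⟩ := exists_free_start (H ∪ P) (2 + k * z) z hBcard
  have hkz1 : 2 + k * z + z = 2 + (k + 1) * z := by ring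
  have hsn : s + 1 < n := by
    have : (k + 1) * z ≤ K * z := Nat.mul_le_mul_right _ hk
    omega
  -- lightness of a non-heavy position
  have light : ∀ c, c < n → c ∉ H → (nbrN 𝓢 c).card ≤ D := by
    intro c hc hcH
    by_contra hD
    push Not at hD
    apply hcH
    rw [hH, Finset.mem_map]
    exact ⟨⟨c, hc⟩, by simp only [heavy, Finset.mem_filter, Finset.mem_univ, true_and]; exact hD, rfl⟩
  -- non-coupling of a non-forbidden position with the old dominoes
  have fresh : ∀ c, c < n → c ∉ P → 2 + k * z ≤ c → ∀ j < k, ∀ b ∈ ({t j, t j + 1} : Finset ℕ),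
      ¬ NCoupled 𝓢 b c ∧ ¬ NCoupled 𝓢 c b := by
    intro c hc hcP hLc j hj b hb
    have hbz := hzone j hj
    have hjz : (j + 1) * z ≤ k * z := Nat.mul_le_mul_right _ hj
    have hb' : b = t j ∨ b = t j + 1 := by simpa using hb
    have hbc : c ≠ b := by rcases hb' with rfl | rfl <;> omega
    have hcnb : c ∉ nbrN 𝓢 b := by
      intro hmem
      apply hcP
      rw [hP, Finset.mem_biUnion]
      refine ⟨j, Finset.mem_range.mpr hj, ?_⟩
      rw [Finset.mem_union]
      rcases hb' with rfl | rfl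
      · exact Or.inl hmem
      · exact Or.inr hmem
    have h1 := not_coupled_of_not_mem hc hbc hcnb
    exact ⟨h1, fun h => h1 (ncoupled_symm h)⟩
  have hsH : s ∉ H := fun h => hsB (Finset.mem_union_left _ h)
  have hs1H : s + 1 ∉ H := fun h => hs1B (Finset.mem_union_left _ h)
  have hsP : s ∉ P := fun h => hsB (Finset.mem_union_right _ h)
  have hs1P : s + 1 ∉ P := fun h => hs1B (Finset.mem_union_right _ h)
  refine ⟨s, ?_, ?_, ?_⟩
  · intro j hj
    by_cases hjk : j = k
    · subst hjk; simp only [if_true]; constructor <;> omega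
    · have hj' : j < k := by omega
      simp only [hjk, if_false]; exact hzone j hj'
  · intro j hj
    by_cases hjk : j = k
    · subst hjk; simp only [if_true]
      exact ⟨light s (by omega) hsH, light (s + 1) hsn hs1H⟩
    · have hj' : j < k := by omega
      simp only [hjk, if_false]; exact hlight j hj'
  · intro j hj j' hj' hjj a ha b hb
    by_cases hjk : j = k
    · subst hjk
      have hj'k : j' ≠ j := fun h => hjj h.symm
      have hj'' : j' < j := by omega
      simp only [if_true, hj'k, if_false] at ha hb
      have ha' : a = s ∨ a = s + 1 := by simpa using ha
      rcases ha' with rfl | rfl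
      · exact (fresh _ (by omega) hsP hLs j' hj'' b hb).2
      · exact (fresh _ hsn hs1P (by omega) j' hj'' b hb).2
    · by_cases hj'k : j' = k
      · subst hj'k
        have hj'' : j < j' := by omega
        simp only [hjk, if_false, if_true] at ha hb
        have hb' : b = s ∨ b = s + 1 := by simpa using hb
        rcases hb' with rfl | rfl
        · exact (fresh _ (by omega) hsP hLs j hj'' a ha).1
        · exact (fresh _ hsn hs1P (by omega) j hj'' a ha).1
      · simp only [hjk, hj'k, if_false] at ha hb
        exact hnc j (by omega) j' (by omega) hjj a ha b hb

/-- Greedy selection of `K` pairwise uncoupled light dominoes, one per zone. -/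
theorem good_all {𝓢 : Set (Finset (Fin n))} {D z K : ℕ} (hKz : K * z + 6 ≤ n)
    (hz : 2 * (heavy 𝓢 D).card + 4 * K * D + 2 ≤ z) : ∀ k ≤ K, ∃ t, Good 𝓢 D z k t := by
  intro k
  induction k with
  | zero => exact fun _ => ⟨fun _ => 0, good_zero 𝓢 D z⟩
  | succ k ih =>
    intro hk
    obtain ⟨t, ht⟩ := ih (by omega)
    obtain ⟨s, hs⟩ := good_succ ht (by omega) hKz hz
    exact ⟨_, hs⟩

/-- `2F+1` good dominoes give `F` insulated windows: insulators `q i = t (2i)`, free pairs `p j = t (2j+1)`. -/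
theorem insulated_of_good {𝓢 : Set (Finset (Fin n))} {D z F : ℕ} {t : ℕ → ℕ}
    (hg : Good 𝓢 D z (2 * F + 1) t) (hKz : (2 * F + 1) * z + 6 ≤ n) : InsulatedWindows 𝓢 F := by
  obtain ⟨hzone, _, hnc⟩ := hg
  refine ⟨fun j => t (2 * j + 1), fun i => t (2 * i), ?_, ?_, ?_, ?_, ?_⟩
  · have := hzone 0 (by omega); simpa using this.1
  · have h := hzone (2 * F) (by omega)
    have : (2 * F + 1) * z = (2 * F + 1) * z := rfl
    nlinarith [h.2, hKz]
  · intro j hj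
    have h0 := hzone (2 * j) (by omega)
    have h1 := hzone (2 * j + 1) (by omega)
    have h2 := hzone (2 * j + 2) (by omega)
    have e1 : (2 * j + 1) * z = 2 * j * z + z := by ring
    have e2 : (2 * j + 1 + 1) * z = 2 * j * z + z + z := by ring
    have e3 : (2 * j + 2) * z = 2 * j * z + z + z := by ring
    have e4 : 2 * (j + 1) = 2 * j + 2 := by ring
    dsimp only
    rw [e4]
    constructor <;> omega
  · intro j hj j' hj' hjj a ha b hb
    exact hnc (2 * j + 1) (by omega) (2 * j' + 1) (by omega) (by omega) a ha b hb
  · intro i hi j hj b hb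
    exact hnc (2 * i) (by omega) (2 * j + 1) (by omega) (by omega) (t (2 * i)) (by simp) b hb

/-- **Window selection from few heavy positions.** -/
theorem insulated_of_light {𝓢 : Set (Finset (Fin n))} {F z D : ℕ} (hKz : (2 * F + 1) * z + 6 ≤ n)
    (hz : 2 * (heavy 𝓢 D).card + 4 * (2 * F + 1) * D + 2 ≤ z) : InsulatedWindows 𝓢 F := by
  obtain ⟨t, ht⟩ := good_all hKz hz (2 * F + 1) le_rfl
  exact insulated_of_good ht hKz

/-- **Window selection from few coupled pairs** (`m = #cpairs`): `4m + (D+1)(4(2F+1)D + 2) ≤ (D+1) z`. -/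
theorem insulated_of_few {𝓢 : Set (Finset (Fin n))} {F z D : ℕ} (hKz : (2 * F + 1) * z + 6 ≤ n)
    (hm : 4 * (cpairs 𝓢).card + (D + 1) * (4 * (2 * F + 1) * D + 2) ≤ (D + 1) * z) :
    InsulatedWindows 𝓢 F := by
  apply insulated_of_light hKz (D := D)
  have hM := heavy_markov 𝓢 D
  -- `(D+1)·(2·#heavy + 4KD + 2) ≤ 4m + (D+1)(4KD+2) ≤ (D+1) z`
  have h1 : (D + 1) * (2 * (heavy 𝓢 D).card + 4 * (2 * F + 1) * D + 2) ≤ (D + 1) * z := by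
    have : (D + 1) * (2 * (heavy 𝓢 D).card + 4 * (2 * F + 1) * D + 2)
        = 2 * ((heavy 𝓢 D).card * (D + 1)) + (D + 1) * (4 * (2 * F + 1) * D + 2) := by ring
    rw [this]
    calc 2 * ((heavy 𝓢 D).card * (D + 1)) + (D + 1) * (4 * (2 * F + 1) * D + 2)
        ≤ 2 * (2 * (cpairs 𝓢).card) + (D + 1) * (4 * (2 * F + 1) * D + 2) :=
          Nat.add_le_add_right (Nat.mul_le_mul_left 2 hM) _
      _ = 4 * (cpairs 𝓢).card + (D + 1) * (4 * (2 * F + 1) * D + 2) := by ring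
      _ ≤ (D + 1) * z := hm
  exact Nat.le_of_mul_le_mul_left h1 (Nat.succ_pos D)

/-- the zone arithmetic: `4m + (D+1)(4KD+2) ≤ (D+1) z` from `64Km ≤ (z+1)(z−5)`, `D = z/(8K)`. -/
theorem arith_core {K z D m : ℕ} (hz : 5 ≤ z) (hDK : D * (8 * K) ≤ z) (hDK' : z < D * (8 * K) + 8 * K)
    (hm : 64 * K * m ≤ (z + 1) * (z - 5)) : 4 * m + (D + 1) * (4 * K * D + 2) ≤ (D + 1) * z := by
  obtain ⟨z', rfl⟩ : ∃ z', z = z' + 5 := ⟨z - 5, by omega⟩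
  rw [Nat.add_sub_cancel] at hm
  have hKpos : 0 < 16 * K := by
    rcases Nat.eq_zero_or_pos K with h | h
    · subst h; simp at hDK'
    · omega
  have h6 : z' + 6 ≤ D * (8 * K) + 8 * K := by omega
  refine Nat.le_of_mul_le_mul_left ?_ hKpos
  calc 16 * K * (4 * m + (D + 1) * (4 * K * D + 2))
      = 64 * K * m + (D * (8 * K) + 8 * K) * (D * (8 * K) + 4) := by ring
    _ ≤ (z' + 6) * z' + (D * (8 * K) + 8 * K) * (D * (8 * K) + 4) := Nat.add_le_add_right hm _
    _ ≤ (D * (8 * K) + 8 * K) * z' + (D * (8 * K) + 8 * K) * (D * (8 * K) + 4) :=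
        Nat.add_le_add_right (Nat.mul_le_mul_right _ h6) _
    _ = (D * (8 * K) + 8 * K) * (z' + (D * (8 * K) + 4)) := by ring
    _ ≤ (D * (8 * K) + 8 * K) * (2 * z' + 10) := Nat.mul_le_mul_left _ (by omega)
    _ = 16 * K * ((D + 1) * (z' + 5)) := by ring

/-- the size arithmetic: with `K = 16k+1`, `z = (n−6)/K`, `n ≥ 22 + 192k` and `m·2^21·k³ ≤ n²`:
`z ≥ 5` and `64Km ≤ (z+1)(z−5)`. -/
theorem arith_n {n k m : ℕ} (hk : 1 ≤ k) (hn : 22 + 192 * k ≤ n) (hm : m * (2 ^ 21 * k ^ 3) ≤ n ^ 2) :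
    5 ≤ (n - 6) / (16 * k + 1) ∧
      64 * (16 * k + 1) * m ≤ ((n - 6) / (16 * k + 1) + 1) * ((n - 6) / (16 * k + 1) - 5) := by
  set K := 16 * k + 1 with hK
  set z := (n - 6) / K with hz
  have hKpos : 0 < K := by omega
  have hzK : z * K ≤ n - 6 := Nat.div_mul_le_self _ _
  have hzK' : n - 6 < z * K + K := Nat.lt_div_mul_add hKpos
  have hz5 : 5 ≤ z := by
    by_contra h
    have h4 : z * K ≤ 4 * K := Nat.mul_le_mul_right _ (by omega)
    omega
  refine ⟨hz5, ?_⟩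
  -- K²(z+1)(z−5) ≥ (n−5)(n−5−6K) ≥ n²/4
  have h1 : n - 5 ≤ z * K + K := by omega
  have h2 : n - 5 - 6 * K ≤ (z - 5) * K := by rw [Nat.sub_mul]; omega
  have h3 : (n - 5) * (n - 5 - 6 * K) ≤ (z * K + K) * ((z - 5) * K) := Nat.mul_le_mul h1 h2
  have h4 : n * n ≤ (2 * (n - 5)) * (2 * (n - 5 - 6 * K)) := Nat.mul_le_mul (by omega) (by omega)
  have hK17 : K ≤ 17 * k := by omega
  have hK3 : K ^ 3 ≤ 4913 * k ^ 3 := by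
    calc K ^ 3 ≤ (17 * k) ^ 3 := Nat.pow_le_pow_left hK17 3
      _ = 4913 * k ^ 3 := by ring
  have h5 : 256 * K ^ 3 * m ≤ n ^ 2 := by
    calc 256 * K ^ 3 * m ≤ 256 * (4913 * k ^ 3) * m := Nat.mul_le_mul_right _ (Nat.mul_le_mul_left _ hK3)
      _ ≤ 2 ^ 21 * k ^ 3 * m := Nat.mul_le_mul_right _ (by norm_num [Nat.mul_assoc]; omega)
      _ = m * (2 ^ 21 * k ^ 3) := by ring
      _ ≤ n ^ 2 := hm
  have hKK : 0 < 4 * K ^ 2 := by positivity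
  refine Nat.le_of_mul_le_mul_left ?_ hKK
  calc 4 * K ^ 2 * (64 * (16 * k + 1) * m) = 256 * K ^ 3 * m := by rw [← hK]; ring
    _ ≤ n ^ 2 := h5
    _ = n * n := by ring
    _ ≤ (2 * (n - 5)) * (2 * (n - 5 - 6 * K)) := h4
    _ = 4 * ((n - 5) * (n - 5 - 6 * K)) := by ring
    _ ≤ 4 * ((z * K + K) * ((z - 5) * K)) := Nat.mul_le_mul_left 4 h3
    _ = 4 * K ^ 2 * ((z + 1) * (z - 5)) := by ring

/-- Numerics: `22 + 192k ≤ 2^k` for `k ≥ 12`. -/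
theorem growthC (k : ℕ) (hk : 12 ≤ k) : 22 + 192 * k ≤ 2 ^ k := by
  induction k, hk using Nat.le_induction with
  | base => norm_num
  | succ k hk ih =>
    have : 22 + 192 * (k + 1) ≤ 2 * (22 + 192 * k) := by omega
    calc 22 + 192 * (k + 1) ≤ 2 * (22 + 192 * k) := this
      _ ≤ 2 * 2 ^ k := Nat.mul_le_mul_left 2 ih
      _ = 2 ^ (k + 1) := by ring

/-- the explicit form of (NP-Γ) (`RingHardSparse3` with `e = 6`, `C = 8`, `n₀ = 200`), proved as
`NPGamma37Proof.ringHardSparse3_explicit`. -/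
def SparseExplicit : Prop :=
  ∀ n ≥ 200, ∀ 𝓢 : Set (Finset (Fin n)), InsulatedWindows 𝓢 (8 * Nat.log 2 n) →
    ∀ P : Fin n → Smolensky.CubeFn (ZMod 3) n,
      (∀ i, P i ∈ Submodule.span (ZMod 3) (Smolensky.mono (ZMod 3) '' 𝓢)) →
      ((univ.filter fun x : Fin n → Bool =>
          OddZeros x ∧ RingHLF.Rel x (fun i => decide (P i x = 1))).card : ℝ) ≤
        (1 - 1 / (n : ℝ) ^ 6) * (2 : ℝ) ^ (n - 1)

/-- **`RingHardFewCouplings3`** (`e = 6`, `C = 2^21`, `n₀ = 4096`) from the explicit (NP-Γ): at most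
`n²/(2^21 (log₂ n)^3)` coupled pairs of positions ⇒ the strategy loses `≥ n^{-6}` of the odd class. -/
theorem ringHardFewCouplings3_of_sparse (hS : SparseExplicit) : RingHardFewCouplings3 := by
  refine ⟨6, 2 ^ 21, 4096, fun n hn 𝓢 hm P hP => ?_⟩
  set k := Nat.log 2 n with hk
  have hk12 : 12 ≤ k := by
    rw [hk]
    exact Nat.le_log_of_pow_le (by norm_num) (by omega)
  have h2k : 2 ^ k ≤ n := Nat.pow_log_le_self 2 (by omega)
  have hnk : 22 + 192 * k ≤ n := (growthC k hk12).trans h2k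
  have hm' : (cpairs (↑𝓢 : Set (Finset (Fin n)))).card * (2 ^ 21 * k ^ 3) ≤ n ^ 2 := hm
  obtain ⟨hz5, hkey⟩ := arith_n (by omega) hnk hm'
  set K := 16 * k + 1 with hK
  set z := (n - 6) / K with hz
  set D := z / (8 * K) with hD
  have hzK : z * K ≤ n - 6 := Nat.div_mul_le_self _ _
  have hDK : D * (8 * K) ≤ z := Nat.div_mul_le_self _ _
  have hDK' : z < D * (8 * K) + 8 * K := Nat.lt_div_mul_add (by omega)
  have hcore := arith_core hz5 hDK hDK' hkey
  have hKz : (2 * (8 * k) + 1) * z + 6 ≤ n := by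
    have : (2 * (8 * k) + 1) * z = z * K := by rw [hK]; ring
    omega
  have hW : InsulatedWindows (↑𝓢 : Set (Finset (Fin n))) (8 * k) :=
    insulated_of_few hKz (D := D) (by
      have : 4 * (2 * (8 * k) + 1) * D + 2 = 4 * K * D + 2 := by rw [hK]; ring
      rw [this]; exact hcore)
  exact hS n (by omega) _ hW P hP

end Summit.QuantumAdvantage.AdviceFreeQNC0.NPGamma37Few
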